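import Mathlib
import HarnessLib
import Summits.Ventures.LatticeQCDFlow.Scaling.AutoregressiveGaugeHeatBathAnyDim

/-!
# LatticeQCDFlow / Scaling — the training loss of a plaquette-block heat-bath model against the full
# weight: `|log((F/Z)/(F_B/Z_B))| ≤ k·log(M/m)` pointwise and `KL(π ‖ q_B) ≤ k·log(M/m)`, `k = #Bᶜ`,
# in every dimension

HONEST FRAMING: exact (Metropolis-corrected) sampling algorithms for lattice gauge theory;
figures of merit are autocorrelation/cost numbers at stated couplings and volumes; no
continuum-physics claim.

Venture `LatticeQCDFlow` (cell pub-lqcd), topic `Scaling`, FANOUT row 30 (lean-1, GEN-24) — OUR WORK on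
THEORY-2.md §4 row C5.  The lineage scores autoregressive models by their training loss
`KL(target ‖ model)` (`…KLExtensive…`: endpoint-blind conditioners pay a VOLUME of nats) and by the
Doeblin data of the exact sampler they drive (`…AnyDim`: acceptance `≥ (m/M)^k`, `τ_int ≤ (M/m)^k − 1/2`).
Here the loss side for the plaquette-block law `q_B = (F_B/Z_B)·Haar^{⊗E}` — the law of the exact
one-plaquette heat-bath sampler of a RANKED `B` (`…Ranked`, `…Comb`, `TorusRankedLayers`) — against the
full weight `π = (F/Z)·Haar^{⊗E}`, `F = ∏_{all p} w(U_p)`, `0 < m ≤ w ≤ M`, `k = #Bᶜ`, any `d`: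

* §1 **`log_density_ratio_abs_le`** — `|log((F(U)/Z)/(F_B(U)/Z_B))| ≤ k·log(M/m)` for EVERY `U`
  (`F/F_B = F_R ∈ [m^k, M^k]` and `Z/Z_B ∈ [m^k, M^k]`);
* §2 **`kl_blockLaw_le`** — `KL(π ‖ q_B) = ∫ (F/Z)·log((F/Z)/(F_B/Z_B)) dHaar^{⊗E} ≤ k·log(M/m)`: for the
  comb of `(ℤ/L)²` (`k = 1`) the loss is `≤ log(M/m)` AT EVERY VOLUME (`= 2β` nats for the Wilson weight),
  for the layers of `(ℤ/L)^d` it is `≤ ((d−1)(d−2)/2·L^d + (d−1)L^{d−1})·log(M/m)`, and by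
  `TorusRankedParityBound` no ranked structure certifies better than `((d−1)(d−2)/2·L^d − 1)·log(M/m)`
  through this bound in `d ≥ 3`.

No `def`, no `sorry`, nothing cited as a fact beyond the tree.
-/

noncomputable section

namespace Summit.Ventures.LatticeQCDFlow.Theory2.Autoregressive

open MeasureTheory Function Finset
open Literature.MathematicalPhysics.QuantumFieldTheory Literature.MathematicalPhysics.QuantumLattice
open Summit.Ventures.LatticeQCDFlow.Exactness Summit.Ventures.LatticeQCDFlow.Scoring

variable {d L : ℕ} [NeZero L] {G : Type*} [Group G] [TopologicalSpace G] [IsTopologicalGroup G]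
  [CompactSpace G] [SecondCountableTopology G] [MeasurableSpace G] [BorelSpace G]

/-! ## §1 The density ratio is squeezed -/

/-- **`Z/Z_B ∈ [m^k, M^k]`**: the full and block partition functions differ by the factor of the `k`
uncovered plaquettes (`w` continuous, `0 < m ≤ w ≤ M`). [ours] -/
theorem integral_prod_div_integral_block_mem_Icc {w : G → ℝ} (hw : Continuous w) {m M : ℝ} (hm0 : 0 < m)
    (hm : ∀ g, m ≤ w g) (hM : ∀ g, w g ≤ M) (B : Finset (Plaquette d L)) :
    m ^ (Finset.univ \ B).card *
        ∫ V, ∏ p ∈ B, w (plaquetteHolonomy V p.1 p.2.1.1 p.2.1.2)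
          ∂(Measure.pi fun _ : Edge d L => haarProbability G) ≤
      ∫ V, ∏ p : Plaquette d L, w (plaquetteHolonomy V p.1 p.2.1.1 p.2.1.2)
          ∂(Measure.pi fun _ : Edge d L => haarProbability G) ∧
    ∫ V, ∏ p : Plaquette d L, w (plaquetteHolonomy V p.1 p.2.1.1 p.2.1.2)
          ∂(Measure.pi fun _ : Edge d L => haarProbability G) ≤
      M ^ (Finset.univ \ B).card *
        ∫ V, ∏ p ∈ B, w (plaquetteHolonomy V p.1 p.2.1.1 p.2.1.2)
          ∂(Measure.pi fun _ : Edge d L => haarProbability G) := by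
  set Haar : Measure (GaugeConfig d L G) := Measure.pi fun _ : Edge d L => haarProbability G with hHaar
  haveI : IsProbabilityMeasure Haar := by rw [hHaar]; infer_instance
  have hw0 : ∀ g, 0 < w g := fun g => hm0.trans_le (hm g)
  have hsplit : ∀ U, (∏ p : Plaquette d L, w (plaquetteHolonomy U p.1 p.2.1.1 p.2.1.2)) =
      (∏ p ∈ Finset.univ \ B, w (plaquetteHolonomy U p.1 p.2.1.1 p.2.1.2)) *
        ∏ p ∈ B, w (plaquetteHolonomy U p.1 p.2.1.1 p.2.1.2) :=
    fun U => (Finset.prod_sdiff (Finset.subset_univ B)).symm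
  have hFBc : Continuous fun U : GaugeConfig d L G => ∏ p ∈ B, w (plaquetteHolonomy U p.1 p.2.1.1 p.2.1.2) :=
    continuous_prodPlaquetteWeight_anyDim hw B
  have hFTc : Continuous fun U : GaugeConfig d L G =>
      ∏ p : Plaquette d L, w (plaquetteHolonomy U p.1 p.2.1.1 p.2.1.2) :=
    continuous_prodPlaquetteWeight_anyDim hw Finset.univ
  have hint : ∀ {F : GaugeConfig d L G → ℝ}, Continuous F → (∀ U, 0 < F U) → ∀ K : ℝ, (∀ U, F U ≤ K) →
      Integrable F Haar := by
    intro F hF hF0 K hK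
    refine Integrable.mono' (integrable_const K) hF.aestronglyMeasurable (ae_of_all _ fun U => ?_)
    rw [Real.norm_eq_abs, abs_of_pos (hF0 U)]; exact hK U
  have hFBi : Integrable (fun U : GaugeConfig d L G => ∏ p ∈ B, w (plaquetteHolonomy U p.1 p.2.1.1 p.2.1.2))
      Haar := hint hFBc (fun U => prod_pos fun p _ => hw0 _) (M ^ B.card)
        fun U => (pow_le_prodPlaquetteWeight_le_pow_anyDim hm0 hm hM _ U).2
  have hFTi : Integrable (fun U : GaugeConfig d L G =>
      ∏ p : Plaquette d L, w (plaquetteHolonomy U p.1 p.2.1.1 p.2.1.2)) Haar :=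
    hint hFTc (fun U => prod_pos fun p _ => hw0 _) (M ^ (Finset.univ : Finset (Plaquette d L)).card)
      fun U => (pow_le_prodPlaquetteWeight_le_pow_anyDim hm0 hm hM _ U).2
  constructor
  · rw [← integral_const_mul]
    refine integral_mono (hFBi.const_mul _) hFTi fun U => ?_
    simp only
    rw [hsplit U]
    exact mul_le_mul_of_nonneg_right (pow_le_prodPlaquetteWeight_le_pow_anyDim hm0 hm hM _ U).1
      (prod_pos fun p _ => hw0 _).le
  · rw [← integral_const_mul]
    refine integral_mono hFTi (hFBi.const_mul _) fun U => ?_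
    simp only
    rw [hsplit U]
    exact mul_le_mul_of_nonneg_right (pow_le_prodPlaquetteWeight_le_pow_anyDim hm0 hm hM _ U).2
      (prod_pos fun p _ => hw0 _).le

/-- **The log-density ratio is squeezed**: `|log((F(U)/Z)/(F_B(U)/Z_B))| ≤ k·log(M/m)` for every `U`
(`w` continuous, `0 < m ≤ w ≤ M`, any `B`, `k = #Bᶜ`). [ours] -/
theorem log_density_ratio_abs_le {w : G → ℝ} (hw : Continuous w) {m M : ℝ} (hm0 : 0 < m)
    (hm : ∀ g, m ≤ w g) (hM : ∀ g, w g ≤ M) (B : Finset (Plaquette d L)) (U : GaugeConfig d L G) :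
    |Real.log (((∏ p : Plaquette d L, w (plaquetteHolonomy U p.1 p.2.1.1 p.2.1.2)) /
          ∫ V, ∏ p : Plaquette d L, w (plaquetteHolonomy V p.1 p.2.1.1 p.2.1.2)
            ∂(Measure.pi fun _ : Edge d L => haarProbability G)) /
        ((∏ p ∈ B, w (plaquetteHolonomy U p.1 p.2.1.1 p.2.1.2)) /
          ∫ V, ∏ p ∈ B, w (plaquetteHolonomy V p.1 p.2.1.1 p.2.1.2)
            ∂(Measure.pi fun _ : Edge d L => haarProbability G)))| ≤
      (Finset.univ \ B).card * Real.log (M / m) := by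
  set Haar : Measure (GaugeConfig d L G) := Measure.pi fun _ : Edge d L => haarProbability G with hHaar
  haveI : IsProbabilityMeasure Haar := by rw [hHaar]; infer_instance
  set k : ℕ := (Finset.univ \ B).card with hk
  set FT : ℝ := ∏ p : Plaquette d L, w (plaquetteHolonomy U p.1 p.2.1.1 p.2.1.2) with hFT
  set FB : ℝ := ∏ p ∈ B, w (plaquetteHolonomy U p.1 p.2.1.1 p.2.1.2) with hFB
  set FR : ℝ := ∏ p ∈ Finset.univ \ B, w (plaquetteHolonomy U p.1 p.2.1.1 p.2.1.2) with hFR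
  set ZT : ℝ := ∫ V, ∏ p : Plaquette d L, w (plaquetteHolonomy V p.1 p.2.1.1 p.2.1.2) ∂Haar with hZT
  set ZB : ℝ := ∫ V, ∏ p ∈ B, w (plaquetteHolonomy V p.1 p.2.1.1 p.2.1.2) ∂Haar with hZB
  have hw0 : ∀ g, 0 < w g := fun g => hm0.trans_le (hm g)
  have hMpos : 0 < M := (hw0 1).trans_le (hM 1)
  have hmM : 0 < M / m := div_pos hMpos hm0
  have hFBpos : 0 < FB := prod_pos fun p _ => hw0 _
  have hFRpos : 0 < FR := prod_pos fun p _ => hw0 _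
  have hsplit : FT = FR * FB := (Finset.prod_sdiff (Finset.subset_univ B)).symm
  have hFRge : m ^ k ≤ FR := (pow_le_prodPlaquetteWeight_le_pow_anyDim hm0 hm hM _ U).1
  have hFRle : FR ≤ M ^ k := (pow_le_prodPlaquetteWeight_le_pow_anyDim hm0 hm hM _ U).2
  have hZ := integral_prod_div_integral_block_mem_Icc (G := G) (L := L) hw hm0 hm hM B
  have hZBpos : 0 < ZB := by
    have hFBi : Integrable (fun V : GaugeConfig d L G =>
        ∏ p ∈ B, w (plaquetteHolonomy V p.1 p.2.1.1 p.2.1.2)) Haar := by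
      refine Integrable.mono' (integrable_const (M ^ B.card))
        (continuous_prodPlaquetteWeight_anyDim hw B).aestronglyMeasurable (ae_of_all _ fun V => ?_)
      rw [Real.norm_eq_abs, abs_of_pos (prod_pos fun p _ => hw0 _)]
      exact (pow_le_prodPlaquetteWeight_le_pow_anyDim hm0 hm hM _ V).2
    have h := integral_mono (integrable_const (m ^ B.card)) hFBi
      fun V => (pow_le_prodPlaquetteWeight_le_pow_anyDim hm0 hm hM B V).1
    rw [integral_const, smul_eq_mul, probReal_univ, one_mul] at h
    exact lt_of_lt_of_le (pow_pos hm0 _) h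
  have hZTpos : 0 < ZT := lt_of_lt_of_le (mul_pos (pow_pos hm0 _) hZBpos) hZ.1
  -- the ratio is `FR · ZB / ZT ∈ [(m/M)^k, (M/m)^k]`
  have hratio : FT / ZT / (FB / ZB) = FR * (ZB / ZT) := by
    rw [hsplit]; field_simp
  rw [hratio]
  have hlo : (m / M) ^ k ≤ FR * (ZB / ZT) := by
    rw [div_pow]
    calc m ^ k / M ^ k = m ^ k * (1 / M ^ k) := by ring
      _ ≤ FR * (ZB / ZT) := by
          refine mul_le_mul hFRge ?_ (by positivity) hFRpos.le
          rw [div_le_div_iff₀ (pow_pos hMpos _) hZTpos, one_mul]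
          have h2 := hZ.2
          rw [mul_comm] at h2
          exact h2
  have hhi : FR * (ZB / ZT) ≤ (M / m) ^ k := by
    rw [div_pow]
    calc FR * (ZB / ZT) ≤ M ^ k * (1 / m ^ k) := by
          refine mul_le_mul hFRle ?_ (by positivity) (pow_nonneg hMpos.le _)
          rw [div_le_div_iff₀ hZTpos (pow_pos hm0 _), one_mul]
          have h1 := hZ.1
          rw [mul_comm] at h1
          exact h1
      _ = M ^ k / m ^ k := by ring
  have hpos : 0 < FR * (ZB / ZT) := mul_pos hFRpos (div_pos hZBpos hZTpos)
  rw [abs_le]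
  constructor
  · have h := Real.log_le_log (pow_pos (div_pos hm0 hMpos) _) hlo
    rw [Real.log_pow, Real.log_div hm0.ne' hMpos.ne'] at h
    rw [Real.log_div hMpos.ne' hm0.ne']
    linarith
  · have h := Real.log_le_log hpos hhi
    rwa [Real.log_pow] at h

/-! ## §2 The training loss -/

/-- **`KL(π ‖ q_B) ≤ k·log(M/m)`**: the Kullback–Leibler divergence of the full law `π = (F/Z)·Haar^{⊗E}`
from the block law `q_B = (F_B/Z_B)·Haar^{⊗E}` — the training loss of the exact one-plaquette heat-bath
model of a ranked `B` against the full target — is at most `#Bᶜ · log(M/m)`: `log(M/m)` for the comb of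
`(ℤ/L)²` at every volume. [ours] -/
theorem kl_blockLaw_le {w : G → ℝ} (hw : Continuous w) {m M : ℝ} (hm0 : 0 < m)
    (hm : ∀ g, m ≤ w g) (hM : ∀ g, w g ≤ M) (B : Finset (Plaquette d L)) :
    ∫ U, (∏ p : Plaquette d L, w (plaquetteHolonomy U p.1 p.2.1.1 p.2.1.2)) /
          (∫ V, ∏ p : Plaquette d L, w (plaquetteHolonomy V p.1 p.2.1.1 p.2.1.2)
            ∂(Measure.pi fun _ : Edge d L => haarProbability G)) *
        Real.log (((∏ p : Plaquette d L, w (plaquetteHolonomy U p.1 p.2.1.1 p.2.1.2)) /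
            ∫ V, ∏ p : Plaquette d L, w (plaquetteHolonomy V p.1 p.2.1.1 p.2.1.2)
              ∂(Measure.pi fun _ : Edge d L => haarProbability G)) /
          ((∏ p ∈ B, w (plaquetteHolonomy U p.1 p.2.1.1 p.2.1.2)) /
            ∫ V, ∏ p ∈ B, w (plaquetteHolonomy V p.1 p.2.1.1 p.2.1.2)
              ∂(Measure.pi fun _ : Edge d L => haarProbability G)))
        ∂(Measure.pi fun _ : Edge d L => haarProbability G) ≤
      (Finset.univ \ B).card * Real.log (M / m) := by
  set Haar : Measure (GaugeConfig d L G) := Measure.pi fun _ : Edge d L => haarProbability G with hHaar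
  haveI : IsProbabilityMeasure Haar := by rw [hHaar]; infer_instance
  set k : ℕ := (Finset.univ \ B).card with hk
  set ZT : ℝ := ∫ V, ∏ p : Plaquette d L, w (plaquetteHolonomy V p.1 p.2.1.1 p.2.1.2) ∂Haar with hZT
  have hw0 : ∀ g, 0 < w g := fun g => hm0.trans_le (hm g)
  have hFTc : Continuous fun U : GaugeConfig d L G =>
      ∏ p : Plaquette d L, w (plaquetteHolonomy U p.1 p.2.1.1 p.2.1.2) :=
    continuous_prodPlaquetteWeight_anyDim hw Finset.univ
  have hFTpos : ∀ U : GaugeConfig d L G, 0 < ∏ p : Plaquette d L, w (plaquetteHolonomy U p.1 p.2.1.1 p.2.1.2) :=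
    fun U => prod_pos fun p _ => hw0 _
  have hFTi : Integrable (fun U : GaugeConfig d L G =>
      ∏ p : Plaquette d L, w (plaquetteHolonomy U p.1 p.2.1.1 p.2.1.2)) Haar := by
    refine Integrable.mono' (integrable_const (M ^ (Finset.univ : Finset (Plaquette d L)).card))
      hFTc.aestronglyMeasurable (ae_of_all _ fun U => ?_)
    rw [Real.norm_eq_abs, abs_of_pos (hFTpos U)]
    exact (pow_le_prodPlaquetteWeight_le_pow_anyDim hm0 hm hM _ U).2
  have hZTpos : 0 < ZT := by
    have h := integral_mono (integrable_const (m ^ (Finset.univ : Finset (Plaquette d L)).card)) hFTi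
      fun V => (pow_le_prodPlaquetteWeight_le_pow_anyDim hm0 hm hM _ V).1
    rw [integral_const, smul_eq_mul, probReal_univ, one_mul] at h
    exact lt_of_lt_of_le (pow_pos hm0 _) h
  have hdens_nonneg : ∀ U : GaugeConfig d L G,
      0 ≤ (∏ p : Plaquette d L, w (plaquetteHolonomy U p.1 p.2.1.1 p.2.1.2)) / ZT :=
    fun U => div_nonneg (hFTpos U).le hZTpos.le
  have hnorm : ∫ U, (∏ p : Plaquette d L, w (plaquetteHolonomy U p.1 p.2.1.1 p.2.1.2)) / ZT ∂Haar = 1 := by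
    rw [integral_div, div_self hZTpos.ne']
  -- pointwise: density · log(ratio) ≤ density · k log(M/m)
  have hpt : ∀ U : GaugeConfig d L G,
      (∏ p : Plaquette d L, w (plaquetteHolonomy U p.1 p.2.1.1 p.2.1.2)) / ZT *
          Real.log (((∏ p : Plaquette d L, w (plaquetteHolonomy U p.1 p.2.1.1 p.2.1.2)) / ZT) /
            ((∏ p ∈ B, w (plaquetteHolonomy U p.1 p.2.1.1 p.2.1.2)) /
              ∫ V, ∏ p ∈ B, w (plaquetteHolonomy V p.1 p.2.1.1 p.2.1.2) ∂Haar)) ≤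
        (∏ p : Plaquette d L, w (plaquetteHolonomy U p.1 p.2.1.1 p.2.1.2)) / ZT * (k * Real.log (M / m)) :=
    fun U => mul_le_mul_of_nonneg_left
      (le_of_abs_le (log_density_ratio_abs_le (G := G) hw hm0 hm hM B U)) (hdens_nonneg U)
  -- integrate (a non-integrable left side has Bochner integral `0 ≤ k·log(M/m)`)
  have hMpos : 0 < M := (hw0 1).trans_le (hM 1)
  have hlog : 0 ≤ Real.log (M / m) := Real.log_nonneg ((one_le_div hm0).2 ((hm 1).trans (hM 1)))
  have hrhs : ∫ U, (∏ p : Plaquette d L, w (plaquetteHolonomy U p.1 p.2.1.1 p.2.1.2)) / ZT *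
      (k * Real.log (M / m)) ∂Haar = k * Real.log (M / m) := by
    rw [integral_mul_const, hnorm, one_mul]
  have hbound_i : Integrable (fun U : GaugeConfig d L G =>
      (∏ p : Plaquette d L, w (plaquetteHolonomy U p.1 p.2.1.1 p.2.1.2)) / ZT * (k * Real.log (M / m))) Haar :=
    (hFTi.div_const _).mul_const _
  by_cases hi : Integrable (fun U : GaugeConfig d L G =>
      (∏ p : Plaquette d L, w (plaquetteHolonomy U p.1 p.2.1.1 p.2.1.2)) / ZT *
          Real.log (((∏ p : Plaquette d L, w (plaquetteHolonomy U p.1 p.2.1.1 p.2.1.2)) / ZT) /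
            ((∏ p ∈ B, w (plaquetteHolonomy U p.1 p.2.1.1 p.2.1.2)) /
              ∫ V, ∏ p ∈ B, w (plaquetteHolonomy V p.1 p.2.1.1 p.2.1.2) ∂Haar))) Haar
  · calc _ ≤ ∫ U, (∏ p : Plaquette d L, w (plaquetteHolonomy U p.1 p.2.1.1 p.2.1.2)) / ZT *
          (k * Real.log (M / m)) ∂Haar := integral_mono hi hbound_i hpt
      _ = k * Real.log (M / m) := hrhs
  · rw [integral_undef hi]
    exact mul_nonneg (Nat.cast_nonneg _) hlog

end Summit.Ventures.LatticeQCDFlow.Theory2.Autoregressive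

end
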